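import Summits.AnomalousDissipation.AnomalousDissipation.Theorems.MomentParityMomentClosureCarrier
import Summits.AnomalousDissipation.AnomalousDissipation.Theorems.MomentParityMomentClosureLimit
import Literature.Topology.FourManifolds.SeifertAlgebraicModelsWeierstrass

/-!
# `MomentParity.MomentClosure` (stmt-AnomalousDissipation-11467): proof

`Summit.AnomalousDissipation.AnomalousDissipation.Theses.MomentParity.MomentClosure` — at fixed
`(f, ν, N, E, ε, R, κ)`, loud `d`-stationary level-`N` measures for every moment order `d`, with the
common support ball `‖u‖ ≤ R` and tail schedule `κ`, yield ONE loud measure with the same bounds that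
is Galerkin-invariant for ALL compactly supported `C¹` cylindrical test functionals with band-limited
fields (FMRT 2001, Ch. IV App. B; Kraichnan-type moment closures made exact in the limit `d → ∞`).

Proof (`momentClosure_proof`).
1. CARRIER. Every `μ_d` is carried by the level ball `K = {u level-N, ‖u‖ ≤ R}`, compact
   (`isCompact_levelBall`, helper I).
2. LIMIT. `exists_limit_measure_of_isCompact` (helper II) gives a probability measure `μ'` carried
   by `K` with `∫ F dμ' ∈ C` whenever `F : H → ℝ` is continuous, `C` closed, `∫ F dμ_d ∈ C`
   eventually in `d`.
3. ROWS. On `K` the enstrophy and every truncated enstrophy are continuous band sums (helper I), the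
   energy `‖u‖²` and every tested generator `u ↦ ⟨F(u), ∇p(u)⟩` (`CylindricalGenerator`) are
   continuous on `H`; energy `≤ E`, dissipation `≥ ε`, the tail schedule and `d`-stationarity for
   EVERY polynomial (true for `μ_d` as soon as `d > deg p`) pass to `μ'` by step 2.
4. UPGRADE. For a `C¹_c` profile `φ`, Weierstrass approximation with first derivatives on the compact
   coordinate image `coords(K) ⊆ ℝᵐ` (`Literature.Topology.FourManifolds.exists_mvPolynomial_close_C1`,
   PROVED in the tree) makes `⟨F(u), Φ'(u)⟩ - ⟨F(u), ∇p(u)⟩ = Σᵢ (∂ᵢφ - ∂ᵢp)(coords u) ⟨F(u), gᵢ⟩`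
   uniformly small on `K`, so `∫ ⟨F(u), Φ'(u)⟩ dμ' = 0`.
-/

noncomputable section

-- `Summit.<Summit>.<Problem>` is the tree's mandated summit-side namespace (CONVENTIONS §2); for this
-- single-conjunct summit the two coincide, so the duplicate is deliberate.
set_option linter.dupNamespace false

namespace Summit.AnomalousDissipation.AnomalousDissipation.Theorems

namespace MomentParityMomentClosure

open MeasureTheory Filter Topology UnitAddTorus
open scoped InnerProductSpace RealInnerProductSpace ENNReal NNReal
open Literature.Analysis.FunctionSpaces Literature.Analysis.FluidPDE
open Summit.AnomalousDissipation.AnomalousDissipation.Theorems.CubicParityLoud.Negative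

/-! ## Enstrophy rows of a measure carried by the level ball -/

/-- **Mean enstrophy of a measure carried by the level ball** is `ofReal` of the mean of the
continuous band enstrophy at level `N`. [folklore] -/
theorem lintegral_eGradNormSq_eq {N : ℕ} {R : ℝ} (hR : 0 ≤ R) {μ : Measure H3} [IsFiniteMeasure μ]
    (hμ : ∀ᵐ u ∂μ, u ∈ {u : H3 | IsLevel N u ∧ ‖u‖ ≤ R}) :
    ∫⁻ u, Torus.eGradNormSq (u.1 : T3 → R3) ∂μ =
      ENNReal.ofReal (∫ u, (4 * Real.pi ^ 2 * ∑ k ∈ Torus.freqBall N, Torus.freqNormSq k *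
        ‖mFourierCoeff (EuclideanSpace.complexify ∘ ((u : H3).1 : T3 → R3)) k‖ ^ 2) ∂μ) :=
  lintegral_eq_ofReal_integral
    (integrable_of_continuous_of_ae_mem (isCompact_levelBall N hR) hμ (continuous_bandEnstrophy _))
    (bandEnstrophy_nonneg _) (hμ.mono fun _ hu => eGradNormSq_coe_of_isLevel hu.1)

/-- **Mean truncated enstrophy of a measure carried by the level ball** is `ofReal` of the mean of
the continuous band enstrophy of the truncation ball. [folklore] -/
theorem lintegral_eGradNormSq_fourierTruncate_eq {N : ℕ} {R : ℝ} (hR : 0 ≤ R) {μ : Measure H3}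
    [IsFiniteMeasure μ] (hμ : ∀ᵐ u ∂μ, u ∈ {u : H3 | IsLevel N u ∧ ‖u‖ ≤ R}) (M : ℕ) :
    ∫⁻ u, Torus.eGradNormSq (Torus.fourierTruncate M (u.1 : T3 → R3)) ∂μ =
      ENNReal.ofReal (∫ u, (4 * Real.pi ^ 2 * ∑ k ∈ Torus.freqBall M, Torus.freqNormSq k *
        ‖mFourierCoeff (EuclideanSpace.complexify ∘ ((u : H3).1 : T3 → R3)) k‖ ^ 2) ∂μ) :=
  lintegral_eq_ofReal_integral
    (integrable_of_continuous_of_ae_mem (isCompact_levelBall N hR) hμ (continuous_bandEnstrophy _))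
    (bandEnstrophy_nonneg _) (ae_of_all _ fun u => eGradNormSq_fourierTruncate_coe M u)

/-- Real form of an extended-real inequality `ofReal a ≤ ofReal b + 1/(n+1)` (`0 ≤ b`). [folklore] -/
theorem ofReal_le_ofReal_add_inv_iff {a b : ℝ} (hb : 0 ≤ b) (n : ℕ) :
    ENNReal.ofReal a ≤ ENNReal.ofReal b + ((n : ℝ≥0∞) + 1)⁻¹ ↔ a - b ≤ ((n : ℝ) + 1)⁻¹ := by
  have hc : (0 : ℝ) < (n : ℝ) + 1 := by positivity
  have hinv : ((n : ℝ≥0∞) + 1)⁻¹ = ENNReal.ofReal (((n : ℝ) + 1)⁻¹) := by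
    rw [ENNReal.ofReal_inv_of_pos hc, ENNReal.ofReal_add (Nat.cast_nonneg n) zero_le_one,
      ENNReal.ofReal_natCast, ENNReal.ofReal_one]
  rw [hinv, ← ENNReal.ofReal_add hb (inv_nonneg.2 hc.le)]
  have hc' : (0 : ℝ) ≤ ((n : ℝ) + 1)⁻¹ := inv_nonneg.2 hc.le
  constructor
  · intro h
    by_cases ha : 0 ≤ a
    · linarith [(ENNReal.ofReal_le_ofReal_iff (by positivity)).1 h]
    · linarith
  · intro h
    exact ENNReal.ofReal_le_ofReal (by linarith)

/-- **The tail clause in real form**: for a measure carried by the level ball, the resolved-dissipation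
inequality `∫ ‖∇u‖² ≤ ∫ ‖∇P_M u‖² + 1/(n+1)` is the inequality `∫ (e_N - e_M) ≤ 1/(n+1)` between the
means of the continuous band enstrophies. [folklore] -/
theorem tail_iff {N : ℕ} {R : ℝ} (hR : 0 ≤ R) {μ : Measure H3} [IsFiniteMeasure μ]
    (hμ : ∀ᵐ u ∂μ, u ∈ {u : H3 | IsLevel N u ∧ ‖u‖ ≤ R}) (M n : ℕ) :
    (∫⁻ u, Torus.eGradNormSq (u.1 : T3 → R3) ∂μ ≤
        (∫⁻ u, Torus.eGradNormSq (Torus.fourierTruncate M (u.1 : T3 → R3)) ∂μ) +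
          ((n : ℝ≥0∞) + 1)⁻¹) ↔
      ∫ u, (4 * Real.pi ^ 2 * ∑ k ∈ Torus.freqBall N, Torus.freqNormSq k *
          ‖mFourierCoeff (EuclideanSpace.complexify ∘ ((u : H3).1 : T3 → R3)) k‖ ^ 2 -
        4 * Real.pi ^ 2 * ∑ k ∈ Torus.freqBall M, Torus.freqNormSq k *
          ‖mFourierCoeff (EuclideanSpace.complexify ∘ ((u : H3).1 : T3 → R3)) k‖ ^ 2) ∂μ ≤
        ((n : ℝ) + 1)⁻¹ := by
  have hiN := integrable_of_continuous_of_ae_mem (isCompact_levelBall N hR) hμ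
    (continuous_bandEnstrophy (Torus.freqBall N))
  have hiM := integrable_of_continuous_of_ae_mem (isCompact_levelBall N hR) hμ
    (continuous_bandEnstrophy (Torus.freqBall M))
  rw [lintegral_eGradNormSq_eq hR hμ, lintegral_eGradNormSq_fourierTruncate_eq hR hμ M,
    integral_sub hiN hiM]
  exact ofReal_le_ofReal_add_inv_iff (integral_nonneg fun u => bandEnstrophy_nonneg _ u) n

/-! ## Generator rows -/

/-- The tested generator of a polynomial observable is the finite combination
`⟨F(u), ∇p(u)⟩ = Σᵢ ∂ᵢp(coords u) ⟨F(u), gᵢ⟩`. [folklore] -/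
theorem nsGeneratorPairing_polyGrad (ν : ℝ) {f : T3 → R3} (hf : Integrable f volume) {m : ℕ}
    {g : Fin m → T3 → R3} (hg : ∀ i, Torus.IsSmooth (g i)) (P : MvPolynomial (Fin m) ℝ) (u : H3) :
    Torus.nsGeneratorPairing ν f u (polyGrad g P u) =
      ∑ i, MvPolynomial.eval (fun j => Torus.pairing u.1 (g j)) (MvPolynomial.pderiv i P) *
        Torus.nsGeneratorPairing ν f u (g i) :=
  Torus.nsGeneratorPairing_sum_smul ν hf u Finset.univ _ fun i _ => hg i

/-- The coefficient `u ↦ ∂ᵢp((u,g₁),…,(u,gₘ))` of `∇p(u)` is continuous on `H`. [folklore] -/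
theorem continuous_eval_pderiv {m : ℕ} {g : Fin m → T3 → R3} (hg : ∀ i, Torus.IsSmooth (g i))
    (Q : MvPolynomial (Fin m) ℝ) :
    Continuous fun u : H3 => MvPolynomial.eval (fun j => Torus.pairing u.1 (g j)) Q :=
  (MvPolynomial.continuous_eval Q).comp
    (continuous_pi fun j => Torus.continuous_pairing_coe ((hg j).memLp 2))

/-- The tested generator `u ↦ ⟨F(u), ∇p(u)⟩` of a polynomial observable is continuous on `H`.
[folklore] -/
theorem continuous_nsGeneratorPairing_polyGrad (ν : ℝ) {f : T3 → R3} (hf : Integrable f volume)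
    {m : ℕ} {g : Fin m → T3 → R3} (hg : ∀ i, Torus.IsSmooth (g i)) (P : MvPolynomial (Fin m) ℝ) :
    Continuous fun u : H3 => Torus.nsGeneratorPairing ν f u (polyGrad g P u) := by
  simp_rw [nsGeneratorPairing_polyGrad ν hf hg P]
  exact continuous_finsetSum _ fun i _ =>
    (continuous_eval_pderiv hg _).mul (Torus.continuous_nsGeneratorPairing ν f (hg i))

/-- **Upgrade from polynomial to `C¹_c` cylindrical tests.** If a probability measure carried by the
level ball annihilates the tested generator of EVERY polynomial observable in the fields of a
cylindrical test functional `Φ`, it annihilates `⟨F(u), Φ'(u)⟩`: Weierstrass approximation with first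
derivatives (`Literature.Topology.FourManifolds.exists_mvPolynomial_close_C1`) of the profile `φ` on
the compact coordinate image of the ball. [folklore] -/
theorem integral_nsGeneratorPairing_grad_eq_zero (ν : ℝ) {f : T3 → R3} (hf : Integrable f volume)
    {N : ℕ} {R : ℝ} (hR : 0 ≤ R) {μ : Measure H3} [IsProbabilityMeasure μ]
    (hμ : ∀ᵐ u ∂μ, u ∈ {u : H3 | IsLevel N u ∧ ‖u‖ ≤ R}) (Φ : Torus.CylindricalTest (Fin 3))
    (hpoly : ∀ P : MvPolynomial (Fin Φ.m) ℝ,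
      ∫ u, Torus.nsGeneratorPairing ν f u (polyGrad Φ.g P u) ∂μ = 0) :
    ∫ u, Torus.nsGeneratorPairing ν f u (Φ.grad u) ∂μ = 0 := by
  set K : Set H3 := {u : H3 | IsLevel N u ∧ ‖u‖ ≤ R} with hK_def
  have hK : IsCompact K := isCompact_levelBall N hR
  -- the coefficients `⟨F(u), gᵢ⟩` and their bound on `K`
  set G : Fin Φ.m → H3 → ℝ := fun i u => Torus.nsGeneratorPairing ν f u (Φ.g i) with hG_def
  have hGc : ∀ i, Continuous (G i) := fun i => Torus.continuous_nsGeneratorPairing ν f (Φ.g_smooth i)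
  have hSc : Continuous fun u => ∑ i, |G i u| := continuous_finsetSum _ fun i _ => (hGc i).abs
  obtain ⟨M₀, hM₀⟩ := hK.exists_bound_of_continuousOn hSc.continuousOn
  set M : ℝ := max M₀ 0 with hM_def
  have hM0 : 0 ≤ M := le_max_right _ _
  have hM : ∀ u ∈ K, ∑ i, |G i u| ≤ M := fun u hu => by
    have h := (hM₀ u hu).trans (le_max_left M₀ 0)
    rwa [Real.norm_of_nonneg (Finset.sum_nonneg fun i _ => abs_nonneg (G i u))] at h
  -- the generator of `Φ` and its continuity / integrability
  have hΦc : Continuous fun u : H3 => Torus.nsGeneratorPairing ν f u (Φ.grad u) :=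
    Torus.continuous_nsGeneratorPairing_grad ν hf Φ
  have hΦi : Integrable (fun u : H3 => Torus.nsGeneratorPairing ν f u (Φ.grad u)) μ :=
    integrable_of_continuous_of_ae_mem hK hμ hΦc
  -- it suffices to make the integral smaller than every `δ > 0`
  have hsmall : ∀ δ : ℝ, 0 < δ → ‖∫ u, Torus.nsGeneratorPairing ν f u (Φ.grad u) ∂μ‖ ≤ δ := by
    intro δ hδ
    have hδ' : 0 < δ / (M + 1) := div_pos hδ (by linarith)
    -- Weierstrass with first derivatives on the compact coordinate image
    obtain ⟨p, -, hp⟩ := Literature.Topology.FourManifolds.exists_mvPolynomial_close_C1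
      Φ.φ_contDiff Φ.φ_compact (hK.image Φ.continuous_coords) hδ'
    have hTc := continuous_nsGeneratorPairing_polyGrad ν hf Φ.g_smooth p
    have hTi : Integrable (fun u : H3 => Torus.nsGeneratorPairing ν f u (polyGrad Φ.g p u)) μ :=
      integrable_of_continuous_of_ae_mem hK hμ hTc
    -- pointwise closeness on `K`
    have hclose : ∀ u ∈ K, ‖Torus.nsGeneratorPairing ν f u (Φ.grad u) -
        Torus.nsGeneratorPairing ν f u (polyGrad Φ.g p u)‖ ≤ δ := by
      intro u hu
      have hcoef : ∀ i : Fin Φ.m, |_root_.fderiv ℝ Φ.φ (Φ.coords u) (EuclideanSpace.single i 1) -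
          MvPolynomial.eval (fun j => Torus.pairing u.1 (Φ.g j)) (MvPolynomial.pderiv i p)| ≤
            δ / (M + 1) := by
        intro i
        have h1 : MvPolynomial.eval (fun j => Torus.pairing u.1 (Φ.g j)) (MvPolynomial.pderiv i p) =
            _root_.fderiv ℝ (fun y : EuclideanSpace ℝ (Fin Φ.m) => MvPolynomial.eval (WithLp.ofLp y) p)
              (Φ.coords u) (EuclideanSpace.single i 1) := by
          rw [Literature.Topology.FourManifolds.fderiv_mvPolynomial_eval_ofLp_single]
          rfl
        have hs : ‖EuclideanSpace.single i (1 : ℝ)‖ = 1 := by simp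
        rw [h1, ← sub_apply, ← Real.norm_eq_abs]
        refine (ContinuousLinearMap.le_opNorm _ _).trans ?_
        rw [hs, mul_one, ← norm_neg, neg_sub]
        exact (hp (Φ.coords u) (Set.mem_image_of_mem _ hu)).le
      rw [Torus.nsGeneratorPairing_grad ν hf Φ u, nsGeneratorPairing_polyGrad ν hf Φ.g_smooth p u,
        ← Finset.sum_sub_distrib]
      calc ‖∑ i, (_root_.fderiv ℝ Φ.φ (Φ.coords u) (EuclideanSpace.single i 1) * G i u -
              MvPolynomial.eval (fun j => Torus.pairing u.1 (Φ.g j)) (MvPolynomial.pderiv i p) *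
                G i u)‖
          ≤ ∑ i, ‖_root_.fderiv ℝ Φ.φ (Φ.coords u) (EuclideanSpace.single i 1) * G i u -
              MvPolynomial.eval (fun j => Torus.pairing u.1 (Φ.g j)) (MvPolynomial.pderiv i p) *
                G i u‖ := norm_sum_le _ _
        _ ≤ ∑ i, δ / (M + 1) * |G i u| := Finset.sum_le_sum fun i _ => by
            rw [← sub_mul, norm_mul, Real.norm_eq_abs, Real.norm_eq_abs]
            exact mul_le_mul_of_nonneg_right (hcoef i) (abs_nonneg _)
        _ = δ / (M + 1) * ∑ i, |G i u| := (Finset.mul_sum _ _ _).symm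
        _ ≤ δ / (M + 1) * M := mul_le_mul_of_nonneg_left (hM u hu) hδ'.le
        _ ≤ δ := by
            rw [div_mul_eq_mul_div, div_le_iff₀ (by linarith)]
            nlinarith
    -- integrate
    have hsub : ∫ u, Torus.nsGeneratorPairing ν f u (Φ.grad u) ∂μ =
        ∫ u, (Torus.nsGeneratorPairing ν f u (Φ.grad u) -
          Torus.nsGeneratorPairing ν f u (polyGrad Φ.g p u)) ∂μ := by
      rw [integral_sub hΦi hTi, hpoly p, sub_zero]
    rw [hsub]
    exact norm_integral_le_of_ae_norm_le (hμ.mono fun u hu => hclose u hu)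
  have h0 : ‖∫ u, Torus.nsGeneratorPairing ν f u (Φ.grad u) ∂μ‖ ≤ 0 :=
    le_of_forall_gt_imp_ge_of_dense fun δ hδ => hsmall δ hδ
  exact norm_le_zero_iff.1 h0

end MomentParityMomentClosure

/-! ## The item -/

open MeasureTheory Filter Topology UnitAddTorus
open scoped InnerProductSpace RealInnerProductSpace ENNReal NNReal
open Literature.Analysis.FunctionSpaces Literature.Analysis.FluidPDE
open Summit.AnomalousDissipation.AnomalousDissipation.Theorems.CubicParityLoud.Negative
open Summit.AnomalousDissipation.AnomalousDissipation.Theses.MomentParity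
open MomentParityMomentClosure

/-- **`MomentClosure` (route `MomentParity`, item stmt-AnomalousDissipation-11467).** At fixed
`(f, ν, N, E, ε, R, κ)`: if for every moment order `d` there is a level-`N` probability measure on `H`,
supported in `‖u‖ ≤ R`, with `κ`-resolved dissipation, `d`-stationary for Galerkin NS (polynomial
cylindrical tests of degree `≤ d - 1` with band-limited fields), mean energy `≤ E` and dissipation
`≥ ε`, then there is ONE such measure which is Galerkin-invariant for ALL compactly supported `C¹`
cylindrical test functionals with band-limited fields. Weak-* compactness on the compact level ball
plus `C¹`-Weierstrass on the coordinate image (module docstring). -/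
theorem momentClosure_proof : MomentClosure := by
  intro f hfs _hfd _hfz ν N E ε R κ _hν hd
  choose μ hμP hμL hμR hμT hμS hμE hμD using hd
  have hf : Integrable f volume := hfs.integrable
  -- the support radius is nonnegative (the measures are probability measures)
  have hR : 0 ≤ R := by
    haveI := hμP 0
    obtain ⟨u, hu⟩ := (hμR 0).exists
    exact (norm_nonneg u).trans hu
  -- 1. the compact carrier
  set K : Set H3 := {u : H3 | IsLevel N u ∧ ‖u‖ ≤ R} with hK_def
  have hK : IsCompact K := isCompact_levelBall N hR
  have hμK : ∀ d, ∀ᵐ u ∂μ d, u ∈ K := fun d => (hμL d).and (hμR d)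
  -- 2. the limit measure
  obtain ⟨μ', hμ'P, hμ'K, hlim⟩ := exists_limit_measure_of_isCompact hK μ hμP hμK
  haveI := hμ'P
  haveI : ∀ d, IsProbabilityMeasure (μ d) := hμP
  refine ⟨μ', hμ'P, hμ'K.mono fun u hu => hu.1, hμ'K.mono fun u hu => hu.2, fun n => ?_,
    fun Φ hΦ => ?_, ?_, ?_⟩
  · -- 3a. the tail schedule
    rw [tail_iff hR hμ'K (κ n) n]
    refine hlim _ ((continuous_bandEnstrophy _).sub (continuous_bandEnstrophy _)) (Set.Iic _)
      isClosed_Iic (Eventually.of_forall fun d => ?_)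
    exact (tail_iff hR (hμK d) (κ n) n).1 (hμT d n)
  · -- 3b/4. generator rows: polynomial tests pass to the limit, then the `C¹` upgrade
    refine ⟨integrable_of_continuous_of_ae_mem hK hμ'K (Torus.continuous_nsGeneratorPairing_grad ν hf Φ),
      integral_nsGeneratorPairing_grad_eq_zero ν hf hR hμ'K Φ fun P => ?_⟩
    have hband : ∀ i, IsBandTest N (Φ.g i) := fun i =>
      ⟨Φ.g_smooth i, Φ.g_divFree i, Φ.g_zeroMean i, hΦ i⟩
    refine hlim _ (continuous_nsGeneratorPairing_polyGrad ν hf Φ.g_smooth P) {0} isClosed_singleton ?_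
    filter_upwards [eventually_ge_atTop (P.totalDegree + 1)] with d hd
    exact (hμS d Φ.m Φ.g P hband hd).2
  · -- 3c. mean energy
    exact hlim (fun u : H3 => ‖u‖ ^ 2) (continuous_norm.pow 2) (Set.Iic E) isClosed_Iic
      (Eventually.of_forall fun d => hμE d)
  · -- 3d. dissipation
    have hcl : IsClosed {t : ℝ | ε ≤ ν * t} := isClosed_le continuous_const (continuous_const.mul continuous_id)
    have key := hlim _ (continuous_bandEnstrophy (Torus.freqBall N)) _ hcl
      (Eventually.of_forall fun d => by
        have h := hμD d
        rw [Torus.ensembleDissipation, Torus.ensembleEnstrophy, lintegral_eGradNormSq_eq hR (hμK d),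
          ENNReal.toReal_ofReal (integral_nonneg (bandEnstrophy_nonneg _))] at h
        exact h)
    rw [Torus.ensembleDissipation, Torus.ensembleEnstrophy, lintegral_eGradNormSq_eq hR hμ'K,
      ENNReal.toReal_ofReal (integral_nonneg (bandEnstrophy_nonneg _))]
    exact key

end Summit.AnomalousDissipation.AnomalousDissipation.Theorems

end
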